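import Summits.BirchSwinnertonDyer.BirchSwinnertonDyer.Theses.PrintX8VS
import Literature.NumberTheory.EllipticCurves.SkinnerUrban2014.PAdicUnitPeriodRatioProofs
import HarnessLib

/-!
# Route `PrintX8VS`, support item `InputSharpFlatMuTransfer` (stmt-BirchSwinnertonDyer-20771): the
# SLIMMED dependency list — the μ-transfer input pair from Sprung 2012 Thm 7.14 (3) and Mazur Cor. 4.1

D-0154 (2) INPUTS→UNCONDITIONAL, `INPUTS-LIST-2.md` §4 T1 «PackSlim» (cell `pub/bsd-wall`, seat
`bsd-inputs-pack-p1`). `InputSharpFlatMuTransfer := InputSharpFlatColemanKatoZeta ∧ InputPeriodUnitThree`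
(children 20772 = Sprung 2012 ♯/♭ Coleman–Kato zeta package `Sprung2012.thm714seq_sharpFlatColemanKato_zeta`,
and 19291 = the period unit at `3`, `realPeriodRat_eq_unit_mul_plusPeriod_three`). The second conjunct
is a THEOREM of the tree over the printed primary Mazur 1978 Cor. 4.1
(`ModularForms.mazur_not_dvd_maninConstant_of_odd`: the Manin constant is prime to every odd `p` with
`p² ∤ N`): `SkinnerUrban2014.realPeriodRat_eq_unit_mul_plusPeriod_three_of_mazur`
(`Literature/…/SkinnerUrban2014/PAdicUnitPeriodRatioProofs.lean`). So the pair follows from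
`InputSharpFlatColemanKatoZeta` and Mazur Cor. 4.1 (`inputSharpFlatMuTransfer_of_slim`), and the period
child alone from Mazur (`inputPeriodUnitThree_of_mazur`). HONEST FRAMING: pure glue over a landed
theorem; Sprung 2012 Thm 7.14 (3) and Mazur Cor. 4.1 stay print hypotheses and the route stays
conditional on them AS TYPED. Nothing here proves BSD; BSD is not proved by any of this.
-/

set_option autoImplicit false
set_option linter.dupNamespace false

namespace Summit.BirchSwinnertonDyer.BirchSwinnertonDyer.Theorems

open Literature.NumberTheory.EllipticCurves
open Summit.BirchSwinnertonDyer.BirchSwinnertonDyer.Theses.PrintX8VS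

/-- **The period child from Mazur 1978 Cor. 4.1**: `InputPeriodUnitThree` (item 19291, `Ω_E = u · Ω⁺_f`
with `u ∈ ℤ_3^×` at good `p = 3` with `E[3]` irreducible) follows from
`ModularForms.mazur_not_dvd_maninConstant_of_odd` by
`SkinnerUrban2014.realPeriodRat_eq_unit_mul_plusPeriod_three_of_mazur`. [folklore] -/
theorem inputPeriodUnitThree_of_mazur (hMazur : ModularForms.mazur_not_dvd_maninConstant_of_odd) :
    Summit.BirchSwinnertonDyer.BirchSwinnertonDyer.Theses.PrintX8VS.InputPeriodUnitThree :=
  SkinnerUrban2014.realPeriodRat_eq_unit_mul_plusPeriod_three_of_mazur hMazur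

/-- **`InputSharpFlatMuTransfer` from `InputSharpFlatColemanKatoZeta` and Mazur 1978 Cor. 4.1**
(route `PrintX8VS`, item stmt-BirchSwinnertonDyer-20771; INPUTS-LIST-2 T1): the Sprung 2012 ♯/♭
Coleman–Kato zeta package (child 20772) verbatim, and the period unit at `3` (child 19291) as the
tree theorem `SkinnerUrban2014.realPeriodRat_eq_unit_mul_plusPeriod_three_of_mazur` over
`ModularForms.mazur_not_dvd_maninConstant_of_odd`. Pure glue; both hypotheses remain print inputs.
[folklore] -/
theorem inputSharpFlatMuTransfer_of_slim
    (hCK : InputSharpFlatColemanKatoZeta)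
    (hMazur : ModularForms.mazur_not_dvd_maninConstant_of_odd) :
    Summit.BirchSwinnertonDyer.BirchSwinnertonDyer.Theses.PrintX8VS.InputSharpFlatMuTransfer :=
  ⟨hCK, inputPeriodUnitThree_of_mazur hMazur⟩

end Summit.BirchSwinnertonDyer.BirchSwinnertonDyer.Theorems
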